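import Mathlib
import Literature.Probability.RandomMatrix.TwoQubitLambdaMaxSchurSection
import Literature.Probability.RandomMatrix.TwoQubitLambdaMaxBoxIntegral
import HarnessLib

/-!
# Volume of the cut simplex (step B of the secular peeling of Zhang–Jiang–Xie 2025, Prop. 6.10)

The Schur-section volume of `…SchurSection` is `π³ · vol₃ (cutSimplex e c)` with
`cutSimplex e c = {s ≥ 0 : Σ sᵢ/eᵢ ≤ c, Σ sᵢ/(½ − eᵢ) ≤ ½ − c}`.  Scaling `sᵢ = c eᵢ uᵢ` turns it
into the standard simplex `{u ≥ 0, Σ uᵢ ≤ 1}` cut by the half-space `Σ hᵢ uᵢ ≤ 1`,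
`hᵢ = c eᵢ / ((½ − c)(½ − eᵢ))` (`volume_cutSimplex_eq_scaled`), whose volume `V(h)` is computed here
by iterated integration over explicit box regions (`…BoxIntegral`) in the three cases that occur
in the peeling (`h₀ ≤ 1`; `h₁ ≤ 1 < h₀`; `h₂ ≤ 1 < h₁`, for `h₀ > h₁ > h₂ > 0`):

* `V = 1/6`,
* `V = −(h₀²h₁ + h₀²h₂ − 3h₀² − h₀h₁h₂ + 3h₀ − 1) / (6 h₀ (h₀−h₁)(h₀−h₂))`,
* `V = (h₀h₁h₂² − 3h₀h₁h₂ + 3h₀h₁ − h₀ − h₁ + h₂) / (6 h₀ h₁ (h₀−h₂)(h₁−h₂))`,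

i.e. the classical divided-difference formula for a simplex cut by a half-space.  In the variables
`(e, c)` this gives the piecewise rational `cutSimplexVol e c` (`volume_cutSimplex`), the `Π(e; c)`
of the peel integrand.  Folklore calculus; no named facts.

## References

* [ZhangJiangXie2025] L. Zhang, X. Jiang, B. Xie, Quantum Inf. Comput. 25 (2025) 598–632 =
  arXiv:2507.02369, §6.2 Prop. 6.10.
-/

noncomputable section

open _root_.MeasureTheory Set Real
open scoped ENNReal

namespace Literature.Probability.RandomMatrix

namespace ZhangJiangXie2025

/-! ## C1. Volumes of box regions and of finite unions of boxes -/

variable {α β : ℝ} {M₁ M₂ : ℝ → ℝ} {L U : ℝ → ℝ → ℝ}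

/-- **Volume of a primed box region** as an iterated integral of the height `U − L`. [folklore] -/
theorem volume_boxRegion'_eq (hM₁ : Continuous M₁) (hM₂ : Continuous M₂)
    (hL : Continuous (Function.uncurry L)) (hU : Continuous (Function.uncurry U))
    (hαβ : α ≤ β) (hM : ∀ v, α ≤ v → v ≤ β → M₁ v ≤ M₂ v)
    (hLU : ∀ v, α ≤ v → v ≤ β → ∀ u, M₁ v ≤ u → u ≤ M₂ v → L u v ≤ U u v)
    {R : ℝ} (hbound : boxRegion' α β M₁ M₂ L U ⊆ Icc (fun _ => -R) (fun _ => R)) :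
    volume (boxRegion' α β M₁ M₂ L U) =
      ENNReal.ofReal (∫ v in α..β, ∫ u in M₁ v..M₂ v, (U u v - L u v)) := by
  have hfin : volume (boxRegion' α β M₁ M₂ L U) ≠ ⊤ :=
    ((measure_mono hbound).trans_lt (by
      rw [Real.volume_Icc_pi]
      exact ENNReal.prod_lt_top fun i _ => ENNReal.ofReal_lt_top)).ne
  have h1 := integral_boxRegion' (fun _ => (1 : ℝ)) continuous_const hM₁ hM₂ hL hU hαβ hM hLU hbound
  rw [setIntegral_const, smul_eq_mul, mul_one, measureReal_def] at h1
  simp only [intervalIntegral.integral_const, smul_eq_mul, mul_one] at h1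
  rw [← h1, ENNReal.ofReal_toReal hfin]

/-- The iterated height integral of a box region is nonnegative. [folklore] -/
theorem integral_boxHeight_nonneg (hαβ : α ≤ β) (hM : ∀ v, α ≤ v → v ≤ β → M₁ v ≤ M₂ v)
    (hLU : ∀ v, α ≤ v → v ≤ β → ∀ u, M₁ v ≤ u → u ≤ M₂ v → L u v ≤ U u v) :
    0 ≤ ∫ v in α..β, ∫ u in M₁ v..M₂ v, (U u v - L u v) :=
  intervalIntegral.integral_nonneg hαβ fun v hv =>
    intervalIntegral.integral_nonneg (hM v hv.1 hv.2) fun u hu =>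
      sub_nonneg.2 (hLU v hv.1 hv.2 u hu.1 hu.2)

/-- **Volume of a set covered a.e. by finitely many disjoint boxes.** [folklore] -/
theorem volume_eq_sum_boxes {n : ℕ} (S : Set (Fin 3 → ℝ)) (B Bc : Fin n → Set (Fin 3 → ℝ))
    (hBm : ∀ i, MeasurableSet (B i)) (hsub : ∀ i, B i ⊆ S)
    (hcov : S ⊆ ⋃ i, Bc i) (hnull : ∀ i, volume (Bc i \ B i) = 0)
    (hdisj : Pairwise (Function.onFun Disjoint B)) :
    volume S = ∑ i, volume (B i) := by
  rw [← tsum_fintype (L := SummationFilter.unconditional _), ← measure_iUnion hdisj hBm]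
  refine measure_congr (ae_eq_set.mpr ⟨?_, ?_⟩)
  · refine measure_mono_null (fun e he => ?_) ((measure_iUnion_null_iff).mpr hnull)
    obtain ⟨heS, hen⟩ := he
    obtain ⟨i, hi⟩ := mem_iUnion.mp (hcov heS)
    exact mem_iUnion.mpr ⟨i, hi, fun hb => hen (mem_iUnion.mpr ⟨i, hb⟩)⟩
  · rw [Set.sdiff_eq_empty.mpr (iUnion_subset hsub)]; exact measure_empty

/-- `∫ₐᵇ (p + q u) du`. [folklore] -/
theorem integral_affine (a b p q : ℝ) :
    ∫ u in a..b, (p + q * u) = p * (b - a) + q * ((b ^ 2 - a ^ 2) / 2) := by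
  rw [intervalIntegral.integral_add (Continuous.intervalIntegrable (by fun_prop) _ _)
    (Continuous.intervalIntegrable (by fun_prop) _ _), intervalIntegral.integral_const,
    intervalIntegral.integral_const_mul, integral_id, smul_eq_mul, mul_comm]

/-- `∫ₐᵇ (p + q v + r v²) dv`. [folklore] -/
theorem integral_quadratic (a b p q r : ℝ) :
    ∫ v in a..b, (p + q * v + r * v ^ 2) =
      p * (b - a) + q * ((b ^ 2 - a ^ 2) / 2) + r * ((b ^ 3 - a ^ 3) / 3) := by
  rw [intervalIntegral.integral_add (Continuous.intervalIntegrable (by fun_prop) _ _)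
    (Continuous.intervalIntegrable (by fun_prop) _ _), integral_affine,
    intervalIntegral.integral_const_mul, integral_pow]
  norm_num

/-! ## C2. The scaled polytope `V(h) = {u ≥ 0, Σ u ≤ 1, Σ hᵢ uᵢ ≤ 1}` -/

/-- The standard simplex cut by the half-space `h₀ u₀ + h₁ u₁ + h₂ u₂ ≤ 1`. [folklore] -/
def Vset (h₀ h₁ h₂ : ℝ) : Set (Fin 3 → ℝ) :=
  {u | (0 ≤ u 0 ∧ 0 ≤ u 1 ∧ 0 ≤ u 2) ∧ u 0 + u 1 + u 2 ≤ 1 ∧ h₀ * u 0 + h₁ * u 1 + h₂ * u 2 ≤ 1}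

/-! ### Case A: `h₀ ≤ 1` — the whole simplex, volume `1/6` -/

/-- In case A the cut is inactive: `V = {u ≥ 0, Σ u ≤ 1}` is one closed box. [folklore] -/
theorem Vset_eq_caseA {h₀ h₁ h₂ : ℝ} (hA : h₀ ≤ 1) (h01 : h₁ ≤ h₀) (h12 : h₂ ≤ h₁) :
    Vset h₀ h₁ h₂ = closedBoxRegion' 0 1 (fun _ => 0) (fun v => 1 - v)
      (fun _ _ => 0) (fun u v => 1 - v - u) := by
  ext u
  simp only [Vset, closedBoxRegion', mem_setOf_eq]
  constructor
  · rintro ⟨⟨a0, a1, a2⟩, hs, -⟩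
    exact ⟨a1, by linarith, a2, by linarith, a0, by linarith⟩
  · rintro ⟨b1, b2, b3, b4, b5, b6⟩
    refine ⟨⟨b5, b1, b3⟩, by linarith, ?_⟩
    have e0 : h₀ * u 0 ≤ u 0 := by nlinarith
    have e1 : h₁ * u 1 ≤ u 1 := by nlinarith
    have e2 : h₂ * u 2 ≤ u 2 := by nlinarith
    linarith

/-- The simplex `{u ≥ 0, Σ u ≤ 1}` has volume `1/6`. [folklore] -/
theorem volume_simplex_box :
    volume (boxRegion' 0 1 (fun _ => (0 : ℝ)) (fun v => 1 - v) (fun _ _ => (0 : ℝ))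
      (fun u v => 1 - v - u)) = ENNReal.ofReal (1 / 6) := by
  rw [volume_boxRegion'_eq (by fun_prop) (by fun_prop) (by fun_prop) (by fun_prop) (by norm_num)
    (fun v h1 h2 => by linarith) (fun v h1 h2 u h3 h4 => by linarith) (R := 1)
    (fun e he => by
      simp only [boxRegion', mem_setOf_eq] at he
      obtain ⟨h1, h2, h3, h4, h5, h6⟩ := he
      rw [mem_Icc, Pi.le_def, Pi.le_def, Fin.forall_fin_succ, Fin.forall_fin_succ, Fin.forall_fin_one,
        Fin.forall_fin_succ, Fin.forall_fin_succ, Fin.forall_fin_one]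
      simp only [Fin.succ_zero_eq_one, Fin.succ_one_eq_two]
      exact ⟨⟨by linarith, by linarith, by linarith⟩, by linarith, by linarith, by linarith⟩)]
  congr 1
  have h1 : ∀ v : ℝ, ∫ u in (0 : ℝ)..(1 - v), (1 - v - u - 0) = (1 - v) ^ 2 / 2 := by
    intro v
    have : (fun u : ℝ => 1 - v - u - 0) = fun u => (1 - v) + (-1) * u := by funext u; ring
    rw [this, integral_affine]; ring
  simp_rw [h1]
  have : (fun v : ℝ => (1 - v) ^ 2 / 2) = fun v => 1 / 2 + (-1) * v + (1 / 2) * v ^ 2 := by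
    funext v; ring
  rw [this, integral_quadratic]; norm_num

/-- **Case A**: `vol V(h) = 1/6` when `0 ≤ h₂ ≤ h₁ ≤ h₀ ≤ 1`. [folklore] -/
theorem volume_Vset_caseA {h₀ h₁ h₂ : ℝ} (hA : h₀ ≤ 1) (h01 : h₁ ≤ h₀) (h12 : h₂ ≤ h₁) :
    volume (Vset h₀ h₁ h₂) = ENNReal.ofReal (1 / 6) := by
  rw [Vset_eq_caseA hA h01 h12, ← volume_simplex_box]
  refine measure_congr (ae_eq_set.mpr ⟨volume_closedBoxRegion'_diff (by fun_prop) (by fun_prop)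
    (by fun_prop) (by fun_prop), ?_⟩)
  rw [Set.sdiff_eq_empty.mpr boxRegion'_subset_closedBoxRegion']; exact measure_empty

/-! ### The bound functions of cases B and C -/

/-- Inner upper bound `(1 − h₁ v − h₂ u)/h₀` (below the break plane). [folklore] -/
def Uh (h₀ h₁ h₂ : ℝ) (u v : ℝ) : ℝ := (1 - h₁ * v - h₂ * u) / h₀

/-- The break line `ℓ(v) = (h₀ − 1 − (h₀ − h₁) v)/(h₀ − h₂)` in the `(v, u)`-plane. [folklore] -/
def ell (h₀ h₁ h₂ : ℝ) (v : ℝ) : ℝ := (h₀ - 1 - (h₀ - h₁) * v) / (h₀ - h₂)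

/-- `v`-intercept of the break line: `(h₀ − 1)/(h₀ − h₁)`. [folklore] -/
def u1L (h₀ h₁ : ℝ) : ℝ := (h₀ - 1) / (h₀ - h₁)

/-- The point where the cut plane leaves the simplex: `(1 − h₂)/(h₁ − h₂)`. [folklore] -/
def u1s (h₁ h₂ : ℝ) : ℝ := (1 - h₂) / (h₁ - h₂)

/-! ### Case B: `h₂ ≤ h₁ ≤ 1 < h₀` — three boxes -/

/-- The open boxes of case B (outer `u 1`, middle `u 2`, inner `u 0`). [folklore] -/
def BxB (h₀ h₁ h₂ : ℝ) : Fin 3 → Set (Fin 3 → ℝ)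
  | 0 => boxRegion' 0 (u1L h₀ h₁) (fun _ => 0) (ell h₀ h₁ h₂) (fun _ _ => 0) (Uh h₀ h₁ h₂)
  | 1 => boxRegion' 0 (u1L h₀ h₁) (ell h₀ h₁ h₂) (fun v => 1 - v) (fun _ _ => 0)
      (fun u v => 1 - v - u)
  | 2 => boxRegion' (u1L h₀ h₁) 1 (fun _ => 0) (fun v => 1 - v) (fun _ _ => 0) (fun u v => 1 - v - u)

/-- The closed boxes of case B. [folklore] -/
def BcxB (h₀ h₁ h₂ : ℝ) : Fin 3 → Set (Fin 3 → ℝ)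
  | 0 => closedBoxRegion' 0 (u1L h₀ h₁) (fun _ => 0) (ell h₀ h₁ h₂) (fun _ _ => 0) (Uh h₀ h₁ h₂)
  | 1 => closedBoxRegion' 0 (u1L h₀ h₁) (ell h₀ h₁ h₂) (fun v => 1 - v) (fun _ _ => 0)
      (fun u v => 1 - v - u)
  | 2 => closedBoxRegion' (u1L h₀ h₁) 1 (fun _ => 0) (fun v => 1 - v) (fun _ _ => 0)
      (fun u v => 1 - v - u)

section caseB

variable {h₀ h₁ h₂ : ℝ}

/-- Case B: `h₀ − h₁ > 0`. [folklore] -/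
theorem caseB_d01 (hB0 : 1 < h₀) (hB1 : h₁ ≤ 1) : 0 < h₀ - h₁ := by linarith

/-- Case B: `h₀ − h₂ > 0`. [folklore] -/
theorem caseB_d02 (hB0 : 1 < h₀) (hB1 : h₁ ≤ 1) (h12 : h₂ ≤ h₁) : 0 < h₀ - h₂ := by linarith

/-- Case B: `0 ≤ u1L`. [folklore] -/
theorem caseB_u1L_nonneg (hB0 : 1 < h₀) (hB1 : h₁ ≤ 1) : 0 ≤ u1L h₀ h₁ :=
  div_nonneg (by linarith) (by linarith)

/-- Case B: `u1L ≤ 1`. [folklore] -/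
theorem caseB_u1L_le_one (hB0 : 1 < h₀) (hB1 : h₁ ≤ 1) : u1L h₀ h₁ ≤ 1 :=
  (div_le_one (by linarith)).mpr (by linarith)

/-- On `[0, u1L]` the break line is above `0`. [folklore] -/
theorem caseB_ell_nonneg (hB0 : 1 < h₀) (hB1 : h₁ ≤ 1) (h12 : h₂ ≤ h₁) {v : ℝ}
    (hv : v ≤ u1L h₀ h₁) : 0 ≤ ell h₀ h₁ h₂ v := by
  have hv' := (le_div_iff₀ (caseB_d01 hB0 hB1)).mp hv
  exact div_nonneg (by nlinarith) (caseB_d02 hB0 hB1 h12).le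

/-- On `[0, 1]` the break line is below the hypotenuse `u = 1 − v`. [folklore] -/
theorem caseB_ell_le (hB0 : 1 < h₀) (hB1 : h₁ ≤ 1) (h12 : h₂ ≤ h₁) {v : ℝ} (hv1 : v ≤ 1) :
    ell h₀ h₁ h₂ v ≤ 1 - v := by
  rw [ell, div_le_iff₀ (caseB_d02 hB0 hB1 h12)]
  nlinarith [mul_nonneg (sub_nonneg.2 h12) (sub_nonneg.2 hv1),
    mul_nonneg (sub_nonneg.2 hB1) (sub_nonneg.2 hv1)]

/-- Case B: the open boxes are measurable. [folklore] -/
theorem caseB_meas : ∀ i, MeasurableSet (BxB h₀ h₁ h₂ i) := by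
  intro i
  match i with
  | 0 =>
    simp only [BxB]
    exact measurableSet_boxRegion' (by fun_prop) (by unfold ell; fun_prop) (by fun_prop)
      (by unfold Uh; fun_prop)
  | 1 =>
    simp only [BxB]
    exact measurableSet_boxRegion' (by unfold ell; fun_prop) (by fun_prop) (by fun_prop)
      (by fun_prop)
  | 2 =>
    simp only [BxB]
    exact measurableSet_boxRegion' (by fun_prop) (by fun_prop) (by fun_prop) (by fun_prop)

/-- Case B: box boundaries are null. [folklore] -/
theorem caseB_null : ∀ i, volume (BcxB h₀ h₁ h₂ i \ BxB h₀ h₁ h₂ i) = 0 := by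
  intro i
  match i with
  | 0 =>
    simp only [BxB, BcxB]
    exact volume_closedBoxRegion'_diff (by fun_prop) (by unfold ell; fun_prop) (by fun_prop)
      (by unfold Uh; fun_prop)
  | 1 =>
    simp only [BxB, BcxB]
    exact volume_closedBoxRegion'_diff (by unfold ell; fun_prop) (by fun_prop) (by fun_prop)
      (by fun_prop)
  | 2 =>
    simp only [BxB, BcxB]
    exact volume_closedBoxRegion'_diff (by fun_prop) (by fun_prop) (by fun_prop) (by fun_prop)

/-- Case B: the open boxes lie in `V(h)`. [folklore] -/
theorem caseB_sub (hB0 : 1 < h₀) (hB1 : h₁ ≤ 1) (h12 : h₂ ≤ h₁) :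
    ∀ i, BxB h₀ h₁ h₂ i ⊆ Vset h₀ h₁ h₂ := by
  have d01 := caseB_d01 hB0 hB1
  have d02 := caseB_d02 hB0 hB1 h12
  have h0 : 0 < h₀ := by linarith
  have hu0 := caseB_u1L_nonneg hB0 hB1
  intro i
  match i with
  | 0 =>
    intro x hx
    simp only [BxB, boxRegion', mem_setOf_eq] at hx
    obtain ⟨a1, a2, a3, a4, a5, a6⟩ := hx
    have a2' := (lt_div_iff₀ d01).mp a2
    have a4' := (lt_div_iff₀ d02).mp a4
    have a6' := (lt_div_iff₀ h0).mp a6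
    refine ⟨⟨a5.le, a1.le, a3.le⟩, ?_, by nlinarith⟩
    have : h₀ * (x 0 + x 1 + x 2) ≤ h₀ * 1 := by nlinarith
    exact le_of_mul_le_mul_left this h0
  | 1 =>
    intro x hx
    simp only [BxB, boxRegion', mem_setOf_eq] at hx
    obtain ⟨a1, a2, a3, a4, a5, a6⟩ := hx
    have a3' := (div_lt_iff₀ d02).mp a3
    refine ⟨⟨a5.le, a1.le, ?_⟩, by linarith, by nlinarith⟩
    have a2' := (lt_div_iff₀ d01).mp a2
    nlinarith
  | 2 =>
    intro x hx
    simp only [BxB, boxRegion', mem_setOf_eq] at hx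
    obtain ⟨a1, a2, a3, a4, a5, a6⟩ := hx
    have a1' := (div_lt_iff₀ d01).mp a1
    refine ⟨⟨a5.le, by linarith [hu0.trans_lt a1], a3.le⟩, by linarith, ?_⟩
    nlinarith [mul_nonneg (by linarith : (0:ℝ) ≤ h₀ - h₂) a3.le]

/-- Case B: `V(h)` is covered by the closed boxes. [folklore] -/
theorem caseB_cover (hB0 : 1 < h₀) :
    Vset h₀ h₁ h₂ ⊆ ⋃ i, BcxB h₀ h₁ h₂ i := by
  have h0 : 0 < h₀ := by linarith
  intro x hx
  obtain ⟨⟨b0, b1, b2⟩, hs, hh⟩ := hx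
  simp only [mem_iUnion]
  rcases le_or_gt (x 1) (u1L h₀ h₁) with hv | hv
  · rcases le_or_gt (x 2) (ell h₀ h₁ h₂ (x 1)) with hu | hu
    · refine ⟨0, ?_⟩
      simp only [BcxB, closedBoxRegion', mem_setOf_eq]
      refine ⟨b1, hv, b2, hu, b0, ?_⟩
      unfold Uh
      rw [le_div_iff₀ h0]; nlinarith
    · refine ⟨1, ?_⟩
      simp only [BcxB, closedBoxRegion', mem_setOf_eq]
      exact ⟨b1, hv, hu.le, by linarith, b0, by linarith⟩
  · refine ⟨2, ?_⟩
    simp only [BcxB, closedBoxRegion', mem_setOf_eq]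
    exact ⟨hv.le, by linarith, b2, by linarith, b0, by linarith⟩

/-- Case B: the open boxes are pairwise disjoint. [folklore] -/
theorem caseB_disj : Pairwise (Function.onFun Disjoint (BxB h₀ h₁ h₂)) := by
  intro i j hij
  match i, j with
  | 0, 0 => exact absurd rfl hij
  | 1, 1 => exact absurd rfl hij
  | 2, 2 => exact absurd rfl hij
  | 0, 1 =>
    refine Set.disjoint_left.mpr fun x ha hb => ?_
    simp only [BxB, boxRegion', mem_setOf_eq] at ha hb
    obtain ⟨-, -, -, a4, -, -⟩ := ha
    obtain ⟨-, -, b3, -, -, -⟩ := hb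
    exact absurd (a4.trans b3) (lt_irrefl _)
  | 1, 0 =>
    refine Set.disjoint_left.mpr fun x ha hb => ?_
    simp only [BxB, boxRegion', mem_setOf_eq] at ha hb
    obtain ⟨-, -, a3, -, -, -⟩ := ha
    obtain ⟨-, -, -, b4, -, -⟩ := hb
    exact absurd (b4.trans a3) (lt_irrefl _)
  | 0, 2 =>
    refine Set.disjoint_left.mpr fun x ha hb => ?_
    simp only [BxB, boxRegion', mem_setOf_eq] at ha hb
    obtain ⟨-, a2, -, -, -, -⟩ := ha
    obtain ⟨b1, -, -, -, -, -⟩ := hb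
    exact absurd (a2.trans b1) (lt_irrefl _)
  | 2, 0 =>
    refine Set.disjoint_left.mpr fun x ha hb => ?_
    simp only [BxB, boxRegion', mem_setOf_eq] at ha hb
    obtain ⟨a1, -, -, -, -, -⟩ := ha
    obtain ⟨-, b2, -, -, -, -⟩ := hb
    exact absurd (b2.trans a1) (lt_irrefl _)
  | 1, 2 =>
    refine Set.disjoint_left.mpr fun x ha hb => ?_
    simp only [BxB, boxRegion', mem_setOf_eq] at ha hb
    obtain ⟨-, a2, -, -, -, -⟩ := ha
    obtain ⟨b1, -, -, -, -, -⟩ := hb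
    exact absurd (a2.trans b1) (lt_irrefl _)
  | 2, 1 =>
    refine Set.disjoint_left.mpr fun x ha hb => ?_
    simp only [BxB, boxRegion', mem_setOf_eq] at ha hb
    obtain ⟨a1, -, -, -, -, -⟩ := ha
    obtain ⟨-, b2, -, -, -, -⟩ := hb
    exact absurd (b2.trans a1) (lt_irrefl _)

/-- Case B, box 0: middle bounds ordered. [folklore] -/
theorem caseB_hM0 (hB0 : 1 < h₀) (hB1 : h₁ ≤ 1) (h12 : h₂ ≤ h₁) :
    ∀ v, 0 ≤ v → v ≤ u1L h₀ h₁ → (fun _ : ℝ => (0 : ℝ)) v ≤ ell h₀ h₁ h₂ v :=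
  fun _ _ hv => caseB_ell_nonneg hB0 hB1 h12 hv

/-- Case B, box 0: inner bounds ordered. [folklore] -/
theorem caseB_hLU0 (hB0 : 1 < h₀) (hB1 : h₁ ≤ 1) (h12 : h₂ ≤ h₁) (h2 : 0 ≤ h₂) :
    ∀ v, 0 ≤ v → v ≤ u1L h₀ h₁ → ∀ u, (fun _ : ℝ => (0 : ℝ)) v ≤ u → u ≤ ell h₀ h₁ h₂ v →
      (fun _ _ : ℝ => (0 : ℝ)) u v ≤ Uh h₀ h₁ h₂ u v := by
  intro v hv0 hv u hu0 hu
  have hu1 := caseB_u1L_le_one hB0 hB1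
  have hu' : u ≤ 1 - v := hu.trans (caseB_ell_le hB0 hB1 h12 (hv.trans hu1))
  have h0 : 0 < h₀ := by linarith
  have p1 : 0 ≤ h₂ * u := mul_nonneg h2 hu0
  have p2 : h₂ * u ≤ 1 * u := mul_le_mul_of_nonneg_right (h12.trans hB1) hu0
  have p3 : h₁ * v ≤ 1 * v := mul_le_mul_of_nonneg_right hB1 hv0
  unfold Uh
  exact div_nonneg (by linarith) h0.le

/-- Case B, box 0 is bounded. [folklore] -/
theorem caseB_bd0 (hB0 : 1 < h₀) (hB1 : h₁ ≤ 1) (h12 : h₂ ≤ h₁) (h2 : 0 ≤ h₂) :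
    BxB h₀ h₁ h₂ 0 ⊆ Icc (fun _ => -1) (fun _ => 1) := by
  have h0 : 0 < h₀ := by linarith
  have hu1 := caseB_u1L_le_one hB0 hB1
  intro x hx
  simp only [BxB, boxRegion', mem_setOf_eq] at hx
  obtain ⟨a1, a2, a3, a4, a5, a6⟩ := hx
  have a4' : x 2 < 1 - x 1 := a4.trans_le (caseB_ell_le hB0 hB1 h12 (a2.le.trans hu1))
  have a6' := (lt_div_iff₀ h0).mp a6
  rw [mem_Icc, Pi.le_def, Pi.le_def, Fin.forall_fin_succ, Fin.forall_fin_succ, Fin.forall_fin_one,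
    Fin.forall_fin_succ, Fin.forall_fin_succ, Fin.forall_fin_one]
  simp only [Fin.succ_zero_eq_one, Fin.succ_one_eq_two]
  refine ⟨⟨by linarith, by linarith, by linarith⟩, ?_, by linarith, by linarith⟩
  nlinarith [mul_nonneg h2 a3.le, mul_nonneg (h2.trans h12) a1.le]

/-- Case B, value of box 0. [folklore] -/
def caseB_v0 (h₀ h₁ h₂ : ℝ) : ℝ :=
  -(h₀ - 1) ^ 2 * (h₀ ^ 2 * h₁ + h₀ ^ 2 * h₂ - 3 * h₀ ^ 2 - 2 * h₀ * h₁ * h₂ + 2 * h₀ * h₁ +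
    2 * h₀ * h₂ - h₁ * h₂) / (6 * h₀ * (h₀ - h₁) ^ 2 * (h₀ - h₂) ^ 2)

/-- Case B, box 0: the height integral. [folklore] -/
theorem caseB_int0 (hB0 : 1 < h₀) (hB1 : h₁ ≤ 1) (h12 : h₂ ≤ h₁) :
    ∫ v in (0 : ℝ)..u1L h₀ h₁, ∫ u in (fun _ : ℝ => (0 : ℝ)) v..ell h₀ h₁ h₂ v,
      (Uh h₀ h₁ h₂ u v - (fun _ _ : ℝ => (0 : ℝ)) u v) = caseB_v0 h₀ h₁ h₂ := by
  have d01 := caseB_d01 hB0 hB1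
  have d02 := caseB_d02 hB0 hB1 h12
  have h0 : 0 < h₀ := by linarith
  have h1 : ∀ v : ℝ, ∫ u in (0 : ℝ)..ell h₀ h₁ h₂ v, (Uh h₀ h₁ h₂ u v - 0) =
      (-(h₀ - 1) * (h₀ * h₂ - 2 * h₀ + h₂) / (2 * h₀ * (h₀ - h₂) ^ 2)) +
      (-(h₀ ^ 2 * h₁ - h₀ ^ 2 * h₂ + h₀ ^ 2 - 2 * h₀ * h₁ + h₁ * h₂) / (h₀ * (h₀ - h₂) ^ 2)) * v +
      ((h₀ - h₁) * (2 * h₀ * h₁ - h₀ * h₂ - h₁ * h₂) / (2 * h₀ * (h₀ - h₂) ^ 2)) * v ^ 2 := by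
    intro v
    have : (fun u : ℝ => Uh h₀ h₁ h₂ u v - 0) = fun u => (1 - h₁ * v) / h₀ + (-h₂ / h₀) * u := by
      funext u; unfold Uh; ring
    rw [this, integral_affine, ell]
    field_simp
    ring
  simp only
  simp_rw [h1]
  rw [integral_quadratic, u1L, caseB_v0]
  field_simp
  ring

/-- Case B, box 0: volume. [folklore] -/
theorem caseB_vol0 (hB0 : 1 < h₀) (hB1 : h₁ ≤ 1) (h12 : h₂ ≤ h₁) (h2 : 0 ≤ h₂) :
    volume (BxB h₀ h₁ h₂ 0) = ENNReal.ofReal (caseB_v0 h₀ h₁ h₂) ∧ 0 ≤ caseB_v0 h₀ h₁ h₂ := by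
  rw [← caseB_int0 hB0 hB1 h12]
  refine ⟨?_, integral_boxHeight_nonneg (caseB_u1L_nonneg hB0 hB1) (caseB_hM0 hB0 hB1 h12)
    (caseB_hLU0 hB0 hB1 h12 h2)⟩
  simp only [BxB]
  exact volume_boxRegion'_eq (by fun_prop) (by unfold ell; fun_prop) (by fun_prop)
    (by unfold Uh; fun_prop) (caseB_u1L_nonneg hB0 hB1) (caseB_hM0 hB0 hB1 h12)
    (caseB_hLU0 hB0 hB1 h12 h2) (caseB_bd0 hB0 hB1 h12 h2)

/-- Case B, box 1: middle bounds ordered. [folklore] -/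
theorem caseB_hM1 (hB0 : 1 < h₀) (hB1 : h₁ ≤ 1) (h12 : h₂ ≤ h₁) :
    ∀ v, 0 ≤ v → v ≤ u1L h₀ h₁ → ell h₀ h₁ h₂ v ≤ (fun v : ℝ => 1 - v) v :=
  fun _ _ hv => caseB_ell_le hB0 hB1 h12 (hv.trans (caseB_u1L_le_one hB0 hB1))

/-- Case B, boxes 1 and 2: inner bounds ordered. [folklore] -/
theorem caseB_hLU12 {a b : ℝ} {M : ℝ → ℝ} :
    ∀ v, a ≤ v → v ≤ b → ∀ u, M v ≤ u → u ≤ (fun v : ℝ => 1 - v) v →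
      (fun _ _ : ℝ => (0 : ℝ)) u v ≤ (fun u v : ℝ => 1 - v - u) u v := by
  intro v _ _ u _ hu
  simp only at hu ⊢
  linarith

/-- Case B, box 1 is bounded. [folklore] -/
theorem caseB_bd1 (hB0 : 1 < h₀) (hB1 : h₁ ≤ 1) (h12 : h₂ ≤ h₁) :
    BxB h₀ h₁ h₂ 1 ⊆ Icc (fun _ => -1) (fun _ => 1) := by
  intro x hx
  simp only [BxB, boxRegion', mem_setOf_eq] at hx
  obtain ⟨a1, a2, a3, a4, a5, a6⟩ := hx
  have a3' : 0 ≤ x 2 := (caseB_ell_nonneg hB0 hB1 h12 a2.le).trans a3.le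
  rw [mem_Icc, Pi.le_def, Pi.le_def, Fin.forall_fin_succ, Fin.forall_fin_succ, Fin.forall_fin_one,
    Fin.forall_fin_succ, Fin.forall_fin_succ, Fin.forall_fin_one]
  simp only [Fin.succ_zero_eq_one, Fin.succ_one_eq_two]
  exact ⟨⟨by linarith, by linarith, by linarith⟩, by linarith, by linarith, by linarith⟩

/-- Case B, value of box 1. [folklore] -/
def caseB_v1 (h₀ h₁ h₂ : ℝ) : ℝ :=
  (h₂ - 1) ^ 2 / (2 * (h₀ - h₂) ^ 2) * (u1L h₀ h₁ - 0) +
    (h₁ - h₂) * (h₂ - 1) / (h₀ - h₂) ^ 2 * ((u1L h₀ h₁ ^ 2 - 0 ^ 2) / 2) +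
    (h₁ - h₂) ^ 2 / (2 * (h₀ - h₂) ^ 2) * ((u1L h₀ h₁ ^ 3 - 0 ^ 3) / 3)

/-- Case B, box 1: the height integral. [folklore] -/
theorem caseB_int1 (hB0 : 1 < h₀) (hB1 : h₁ ≤ 1) (h12 : h₂ ≤ h₁) :
    ∫ v in (0 : ℝ)..u1L h₀ h₁, ∫ u in ell h₀ h₁ h₂ v..(fun v : ℝ => 1 - v) v,
      ((fun u v : ℝ => 1 - v - u) u v - (fun _ _ : ℝ => (0 : ℝ)) u v) = caseB_v1 h₀ h₁ h₂ := by
  have d02 := caseB_d02 hB0 hB1 h12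
  have h1 : ∀ v : ℝ, ∫ u in ell h₀ h₁ h₂ v..(1 - v), (1 - v - u - 0) =
      (h₂ - 1) ^ 2 / (2 * (h₀ - h₂) ^ 2) + ((h₁ - h₂) * (h₂ - 1) / (h₀ - h₂) ^ 2) * v +
      ((h₁ - h₂) ^ 2 / (2 * (h₀ - h₂) ^ 2)) * v ^ 2 := by
    intro v
    have : (fun u : ℝ => 1 - v - u - 0) = fun u => (1 - v) + (-1) * u := by funext u; ring
    rw [this, integral_affine, ell]
    field_simp
    ring
  simp only
  simp_rw [h1]
  rw [integral_quadratic, caseB_v1]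

/-- Case B, box 1: volume. [folklore] -/
theorem caseB_vol1 (hB0 : 1 < h₀) (hB1 : h₁ ≤ 1) (h12 : h₂ ≤ h₁) :
    volume (BxB h₀ h₁ h₂ 1) = ENNReal.ofReal (caseB_v1 h₀ h₁ h₂) ∧ 0 ≤ caseB_v1 h₀ h₁ h₂ := by
  rw [← caseB_int1 hB0 hB1 h12]
  refine ⟨?_, integral_boxHeight_nonneg (caseB_u1L_nonneg hB0 hB1) (caseB_hM1 hB0 hB1 h12)
    caseB_hLU12⟩
  simp only [BxB]
  exact volume_boxRegion'_eq (by unfold ell; fun_prop) (by fun_prop) (by fun_prop)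
    (by fun_prop) (caseB_u1L_nonneg hB0 hB1) (caseB_hM1 hB0 hB1 h12) caseB_hLU12
    (caseB_bd1 hB0 hB1 h12)

/-- Case B, box 2: middle bounds ordered. [folklore] -/
theorem caseB_hM2 : ∀ v, u1L h₀ h₁ ≤ v → v ≤ 1 → (fun _ : ℝ => (0 : ℝ)) v ≤ (fun v : ℝ => 1 - v) v := by
  intro v _ hv
  simp only
  linarith

/-- Case B, box 2 is bounded. [folklore] -/
theorem caseB_bd2 (hB0 : 1 < h₀) (hB1 : h₁ ≤ 1) :
    BxB h₀ h₁ h₂ 2 ⊆ Icc (fun _ => -1) (fun _ => 1) := by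
  have hu0 := caseB_u1L_nonneg hB0 hB1
  intro x hx
  simp only [BxB, boxRegion', mem_setOf_eq] at hx
  obtain ⟨a1, a2, a3, a4, a5, a6⟩ := hx
  have a1' : 0 ≤ x 1 := hu0.trans a1.le
  rw [mem_Icc, Pi.le_def, Pi.le_def, Fin.forall_fin_succ, Fin.forall_fin_succ, Fin.forall_fin_one,
    Fin.forall_fin_succ, Fin.forall_fin_succ, Fin.forall_fin_one]
  simp only [Fin.succ_zero_eq_one, Fin.succ_one_eq_two]
  exact ⟨⟨by linarith, by linarith, by linarith⟩, by linarith, by linarith, by linarith⟩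

/-- Case B, value of box 2. [folklore] -/
def caseB_v2 (h₀ h₁ : ℝ) : ℝ :=
  1 / 2 * (1 - u1L h₀ h₁) + (-1) * ((1 ^ 2 - u1L h₀ h₁ ^ 2) / 2) +
    1 / 2 * ((1 ^ 3 - u1L h₀ h₁ ^ 3) / 3)

/-- Case B, box 2: the height integral. [folklore] -/
theorem caseB_int2 :
    ∫ v in u1L h₀ h₁..(1 : ℝ), ∫ u in (fun _ : ℝ => (0 : ℝ)) v..(fun v : ℝ => 1 - v) v,
      ((fun u v : ℝ => 1 - v - u) u v - (fun _ _ : ℝ => (0 : ℝ)) u v) = caseB_v2 h₀ h₁ := by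
  have h1 : ∀ v : ℝ, ∫ u in (0 : ℝ)..(1 - v), (1 - v - u - 0) =
      1 / 2 + (-1) * v + (1 / 2) * v ^ 2 := by
    intro v
    have : (fun u : ℝ => 1 - v - u - 0) = fun u => (1 - v) + (-1) * u := by funext u; ring
    rw [this, integral_affine]
    ring
  simp only
  simp_rw [h1]
  rw [integral_quadratic, caseB_v2]

/-- Case B, box 2: volume. [folklore] -/
theorem caseB_vol2 (hB0 : 1 < h₀) (hB1 : h₁ ≤ 1) :
    volume (BxB h₀ h₁ h₂ 2) = ENNReal.ofReal (caseB_v2 h₀ h₁) ∧ 0 ≤ caseB_v2 h₀ h₁ := by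
  rw [← caseB_int2]
  refine ⟨?_, integral_boxHeight_nonneg (caseB_u1L_le_one hB0 hB1) caseB_hM2 caseB_hLU12⟩
  simp only [BxB]
  exact volume_boxRegion'_eq (by fun_prop) (by fun_prop) (by fun_prop) (by fun_prop)
    (caseB_u1L_le_one hB0 hB1) caseB_hM2 caseB_hLU12 (caseB_bd2 (h₂ := h₂) hB0 hB1)

/-- The case-B volume of `V(h)`. [folklore] -/
def VB (h₀ h₁ h₂ : ℝ) : ℝ :=
  -(h₀ ^ 2 * h₁ + h₀ ^ 2 * h₂ - 3 * h₀ ^ 2 - h₀ * h₁ * h₂ + 3 * h₀ - 1) /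
    (6 * h₀ * (h₀ - h₁) * (h₀ - h₂))

/-- **Case B**: `vol V(h) = V_B(h)` when `0 ≤ h₂ ≤ h₁ ≤ 1 < h₀`. [folklore] -/
theorem volume_Vset_caseB (hB0 : 1 < h₀) (hB1 : h₁ ≤ 1) (h12 : h₂ ≤ h₁) (h2 : 0 ≤ h₂) :
    volume (Vset h₀ h₁ h₂) = ENNReal.ofReal (VB h₀ h₁ h₂) := by
  have d01 := caseB_d01 hB0 hB1
  have d02 := caseB_d02 hB0 hB1 h12
  have h0 : 0 < h₀ := by linarith
  obtain ⟨e0, n0⟩ := caseB_vol0 hB0 hB1 h12 h2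
  obtain ⟨e1, n1⟩ := caseB_vol1 hB0 hB1 h12
  obtain ⟨e2, n2⟩ := caseB_vol2 (h₂ := h₂) hB0 hB1
  rw [volume_eq_sum_boxes (Vset h₀ h₁ h₂) (BxB h₀ h₁ h₂) (BcxB h₀ h₁ h₂) caseB_meas
    (caseB_sub hB0 hB1 h12) (caseB_cover hB0) caseB_null caseB_disj, Fin.sum_univ_three, e0, e1, e2,
    ← ENNReal.ofReal_add n0 n1, ← ENNReal.ofReal_add (add_nonneg n0 n1) n2]
  congr 1
  rw [caseB_v0, caseB_v1, caseB_v2, VB, u1L]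
  field_simp
  ring

end caseB


/-! ### Case C: `0 < h₂ ≤ 1 < h₁ < h₀` — three boxes -/

/-- The open boxes of case C (outer `u 1`, middle `u 2`, inner `u 0`). [folklore] -/
def BxC (h₀ h₁ h₂ : ℝ) : Fin 3 → Set (Fin 3 → ℝ)
  | 0 => boxRegion' 0 (u1s h₁ h₂) (fun _ => 0) (ell h₀ h₁ h₂) (fun _ _ => 0) (Uh h₀ h₁ h₂)
  | 1 => boxRegion' 0 (u1s h₁ h₂) (ell h₀ h₁ h₂) (fun v => 1 - v) (fun _ _ => 0)
      (fun u v => 1 - v - u)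
  | 2 => boxRegion' (u1s h₁ h₂) (1 / h₁) (fun _ => 0) (fun v => (1 - h₁ * v) / h₂) (fun _ _ => 0)
      (Uh h₀ h₁ h₂)

/-- The closed boxes of case C. [folklore] -/
def BcxC (h₀ h₁ h₂ : ℝ) : Fin 3 → Set (Fin 3 → ℝ)
  | 0 => closedBoxRegion' 0 (u1s h₁ h₂) (fun _ => 0) (ell h₀ h₁ h₂) (fun _ _ => 0) (Uh h₀ h₁ h₂)
  | 1 => closedBoxRegion' 0 (u1s h₁ h₂) (ell h₀ h₁ h₂) (fun v => 1 - v) (fun _ _ => 0)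
      (fun u v => 1 - v - u)
  | 2 => closedBoxRegion' (u1s h₁ h₂) (1 / h₁) (fun _ => 0) (fun v => (1 - h₁ * v) / h₂)
      (fun _ _ => 0) (Uh h₀ h₁ h₂)

section caseC

variable {h₀ h₁ h₂ : ℝ}

/-- Case C: `0 ≤ u1s`. [folklore] -/
theorem caseC_u1s_nonneg (hC1 : 1 < h₁) (hC2 : h₂ ≤ 1) : 0 ≤ u1s h₁ h₂ :=
  div_nonneg (by linarith) (by linarith)

/-- Case C: `u1s ≤ 1/h₁`. [folklore] -/
theorem caseC_u1s_le (hC1 : 1 < h₁) (hC2 : h₂ ≤ 1) (h2 : 0 < h₂) : u1s h₁ h₂ ≤ 1 / h₁ := by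
  rw [u1s, div_le_div_iff₀ (by linarith) (by linarith)]
  nlinarith

/-- Case C: `1/h₁ ≤ 1`. [folklore] -/
theorem caseC_inv_le (hC1 : 1 < h₁) : 1 / h₁ ≤ 1 := (div_le_one (by linarith)).mpr hC1.le

/-- Case C: on `[0, 1/h₁]` the break line is above `0`. [folklore] -/
theorem caseC_ell_nonneg (hC1 : 1 < h₁) (h01 : h₁ < h₀) (hC2 : h₂ ≤ 1) {v : ℝ}
    (hv : v ≤ 1 / h₁) : 0 ≤ ell h₀ h₁ h₂ v := by
  have h1 : 0 < h₁ := by linarith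
  have hv' := (le_div_iff₀ h1).mp hv
  have key : (h₀ - h₁) * v ≤ h₀ - 1 := by nlinarith
  exact div_nonneg (by linarith) (by linarith)

/-- Case C: on `[0, u1s]` the break line is below the hypotenuse. [folklore] -/
theorem caseC_ell_le (hC1 : 1 < h₁) (h01 : h₁ < h₀) (hC2 : h₂ ≤ 1) {v : ℝ} (hv : v ≤ u1s h₁ h₂) :
    ell h₀ h₁ h₂ v ≤ 1 - v := by
  have d12 : 0 < h₁ - h₂ := by linarith
  have hv' := (le_div_iff₀ d12).mp hv
  rw [ell, div_le_iff₀ (by linarith)]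
  nlinarith

/-- Case C: the open boxes are measurable. [folklore] -/
theorem caseC_meas : ∀ i, MeasurableSet (BxC h₀ h₁ h₂ i) := by
  intro i
  match i with
  | 0 =>
    simp only [BxC]
    exact measurableSet_boxRegion' (by fun_prop) (by unfold ell; fun_prop) (by fun_prop)
      (by unfold Uh; fun_prop)
  | 1 =>
    simp only [BxC]
    exact measurableSet_boxRegion' (by unfold ell; fun_prop) (by fun_prop) (by fun_prop)
      (by fun_prop)
  | 2 =>
    simp only [BxC]
    exact measurableSet_boxRegion' (by fun_prop) (by fun_prop) (by fun_prop) (by unfold Uh; fun_prop)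

/-- Case C: box boundaries are null. [folklore] -/
theorem caseC_null : ∀ i, volume (BcxC h₀ h₁ h₂ i \ BxC h₀ h₁ h₂ i) = 0 := by
  intro i
  match i with
  | 0 =>
    simp only [BxC, BcxC]
    exact volume_closedBoxRegion'_diff (by fun_prop) (by unfold ell; fun_prop) (by fun_prop)
      (by unfold Uh; fun_prop)
  | 1 =>
    simp only [BxC, BcxC]
    exact volume_closedBoxRegion'_diff (by unfold ell; fun_prop) (by fun_prop) (by fun_prop)
      (by fun_prop)
  | 2 =>
    simp only [BxC, BcxC]
    exact volume_closedBoxRegion'_diff (by fun_prop) (by fun_prop) (by fun_prop)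
      (by unfold Uh; fun_prop)

/-- Case C: the open boxes lie in `V(h)`. [folklore] -/
theorem caseC_sub (hC1 : 1 < h₁) (h01 : h₁ < h₀) (hC2 : h₂ ≤ 1) (h2 : 0 < h₂) :
    ∀ i, BxC h₀ h₁ h₂ i ⊆ Vset h₀ h₁ h₂ := by
  have d01 : 0 < h₀ - h₁ := by linarith
  have d02 : 0 < h₀ - h₂ := by linarith
  have d12 : 0 < h₁ - h₂ := by linarith
  have h0 : 0 < h₀ := by linarith
  have hu0 := caseC_u1s_nonneg hC1 hC2
  intro i
  match i with
  | 0 =>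
    intro x hx
    simp only [BxC, boxRegion', mem_setOf_eq] at hx
    obtain ⟨a1, a2, a3, a4, a5, a6⟩ := hx
    have a4' := (lt_div_iff₀ d02).mp a4
    have a6' := (lt_div_iff₀ h0).mp a6
    refine ⟨⟨a5.le, a1.le, a3.le⟩, ?_, by nlinarith⟩
    have : h₀ * (x 0 + x 1 + x 2) ≤ h₀ * 1 := by nlinarith
    exact le_of_mul_le_mul_left this h0
  | 1 =>
    intro x hx
    simp only [BxC, boxRegion', mem_setOf_eq] at hx
    obtain ⟨a1, a2, a3, a4, a5, a6⟩ := hx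
    have a3' := (div_lt_iff₀ d02).mp a3
    have hell : 0 ≤ ell h₀ h₁ h₂ (x 1) :=
      caseC_ell_nonneg hC1 h01 hC2 (a2.le.trans (caseC_u1s_le hC1 hC2 h2))
    refine ⟨⟨a5.le, a1.le, hell.trans a3.le⟩, by linarith, by nlinarith⟩
  | 2 =>
    intro x hx
    simp only [BxC, boxRegion', mem_setOf_eq] at hx
    obtain ⟨a1, a2, a3, a4, a5, a6⟩ := hx
    have a1' := (div_lt_iff₀ d12).mp a1
    have a4' := (lt_div_iff₀ h2).mp a4
    have a6' := (lt_div_iff₀ h0).mp a6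
    refine ⟨⟨a5.le, hu0.trans a1.le, a3.le⟩, ?_, by nlinarith⟩
    -- the sum constraint: below the break plane beyond `u1s`
    have hB' : (h₀ - h₂) * (x 2 * h₂) < (h₀ - h₂) * (1 - h₁ * x 1) := mul_lt_mul_of_pos_left a4' d02
    have hC' : h₀ * (1 - h₂) < h₀ * (x 1 * (h₁ - h₂)) := mul_lt_mul_of_pos_left a1' h0
    have key : h₂ * ((h₀ - h₁) * x 1 + (h₀ - h₂) * x 2) < h₂ * (h₀ - 1) := by nlinarith
    have key' := lt_of_mul_lt_mul_left key h2.le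
    have : h₀ * (x 0 + x 1 + x 2) ≤ h₀ * 1 := by nlinarith
    exact le_of_mul_le_mul_left this h0

/-- Case C: `V(h)` is covered by the closed boxes. [folklore] -/
theorem caseC_cover (hC1 : 1 < h₁) (h01 : h₁ < h₀) (h2 : 0 < h₂) :
    Vset h₀ h₁ h₂ ⊆ ⋃ i, BcxC h₀ h₁ h₂ i := by
  have h0 : 0 < h₀ := by linarith
  have h1 : 0 < h₁ := by linarith
  intro x hx
  obtain ⟨⟨b0, b1, b2⟩, hs, hh⟩ := hx
  simp only [mem_iUnion]
  rcases le_or_gt (x 1) (u1s h₁ h₂) with hv | hv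
  · rcases le_or_gt (x 2) (ell h₀ h₁ h₂ (x 1)) with hu | hu
    · refine ⟨0, ?_⟩
      simp only [BcxC, closedBoxRegion', mem_setOf_eq]
      refine ⟨b1, hv, b2, hu, b0, ?_⟩
      unfold Uh
      rw [le_div_iff₀ h0]; nlinarith
    · refine ⟨1, ?_⟩
      simp only [BcxC, closedBoxRegion', mem_setOf_eq]
      exact ⟨b1, hv, hu.le, by linarith, b0, by linarith⟩
  · refine ⟨2, ?_⟩
    simp only [BcxC, closedBoxRegion', mem_setOf_eq]
    have p0 : 0 ≤ h₀ * x 0 := mul_nonneg h0.le b0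
    have p2 : 0 ≤ h₂ * x 2 := mul_nonneg h2.le b2
    refine ⟨hv.le, ?_, b2, ?_, b0, ?_⟩
    · rw [le_div_iff₀ h1]; nlinarith
    · rw [le_div_iff₀ h2]; nlinarith
    · unfold Uh
      rw [le_div_iff₀ h0]; nlinarith

/-- Case C: the open boxes are pairwise disjoint. [folklore] -/
theorem caseC_disj : Pairwise (Function.onFun Disjoint (BxC h₀ h₁ h₂)) := by
  intro i j hij
  match i, j with
  | 0, 0 => exact absurd rfl hij
  | 1, 1 => exact absurd rfl hij
  | 2, 2 => exact absurd rfl hij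
  | 0, 1 =>
    refine Set.disjoint_left.mpr fun x ha hb => ?_
    simp only [BxC, boxRegion', mem_setOf_eq] at ha hb
    obtain ⟨-, -, -, a4, -, -⟩ := ha
    obtain ⟨-, -, b3, -, -, -⟩ := hb
    exact absurd (a4.trans b3) (lt_irrefl _)
  | 1, 0 =>
    refine Set.disjoint_left.mpr fun x ha hb => ?_
    simp only [BxC, boxRegion', mem_setOf_eq] at ha hb
    obtain ⟨-, -, a3, -, -, -⟩ := ha
    obtain ⟨-, -, -, b4, -, -⟩ := hb
    exact absurd (b4.trans a3) (lt_irrefl _)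
  | 0, 2 =>
    refine Set.disjoint_left.mpr fun x ha hb => ?_
    simp only [BxC, boxRegion', mem_setOf_eq] at ha hb
    obtain ⟨-, a2, -, -, -, -⟩ := ha
    obtain ⟨b1, -, -, -, -, -⟩ := hb
    exact absurd (a2.trans b1) (lt_irrefl _)
  | 2, 0 =>
    refine Set.disjoint_left.mpr fun x ha hb => ?_
    simp only [BxC, boxRegion', mem_setOf_eq] at ha hb
    obtain ⟨a1, -, -, -, -, -⟩ := ha
    obtain ⟨-, b2, -, -, -, -⟩ := hb
    exact absurd (b2.trans a1) (lt_irrefl _)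
  | 1, 2 =>
    refine Set.disjoint_left.mpr fun x ha hb => ?_
    simp only [BxC, boxRegion', mem_setOf_eq] at ha hb
    obtain ⟨-, a2, -, -, -, -⟩ := ha
    obtain ⟨b1, -, -, -, -, -⟩ := hb
    exact absurd (a2.trans b1) (lt_irrefl _)
  | 2, 1 =>
    refine Set.disjoint_left.mpr fun x ha hb => ?_
    simp only [BxC, boxRegion', mem_setOf_eq] at ha hb
    obtain ⟨a1, -, -, -, -, -⟩ := ha
    obtain ⟨-, b2, -, -, -, -⟩ := hb
    exact absurd (b2.trans a1) (lt_irrefl _)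

/-- Case C, box 0: middle bounds ordered. [folklore] -/
theorem caseC_hM0 (hC1 : 1 < h₁) (h01 : h₁ < h₀) (hC2 : h₂ ≤ 1) (h2 : 0 < h₂) :
    ∀ v, 0 ≤ v → v ≤ u1s h₁ h₂ → (fun _ : ℝ => (0 : ℝ)) v ≤ ell h₀ h₁ h₂ v :=
  fun _ _ hv => caseC_ell_nonneg hC1 h01 hC2 (hv.trans (caseC_u1s_le hC1 hC2 h2))

/-- Case C, box 0: inner bounds ordered. [folklore] -/
theorem caseC_hLU0 (hC1 : 1 < h₁) (h01 : h₁ < h₀) (hC2 : h₂ ≤ 1) (h2 : 0 < h₂) :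
    ∀ v, 0 ≤ v → v ≤ u1s h₁ h₂ → ∀ u, (fun _ : ℝ => (0 : ℝ)) v ≤ u → u ≤ ell h₀ h₁ h₂ v →
      (fun _ _ : ℝ => (0 : ℝ)) u v ≤ Uh h₀ h₁ h₂ u v := by
  intro v hv0 hv u hu0 hu
  have d12 : 0 < h₁ - h₂ := by linarith
  have hu' : u ≤ 1 - v := hu.trans (caseC_ell_le hC1 h01 hC2 hv)
  have hv' := (le_div_iff₀ d12).mp hv
  have h0 : 0 < h₀ := by linarith
  have p1 : h₂ * u ≤ h₂ * (1 - v) := mul_le_mul_of_nonneg_left hu' h2.le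
  unfold Uh
  exact div_nonneg (by nlinarith) h0.le

/-- Case C, box 0 is bounded. [folklore] -/
theorem caseC_bd0 (hC1 : 1 < h₁) (h01 : h₁ < h₀) (hC2 : h₂ ≤ 1) (h2 : 0 < h₂) :
    BxC h₀ h₁ h₂ 0 ⊆ Icc (fun _ => -1) (fun _ => 1) := by
  have h0 : 0 < h₀ := by linarith
  have hu1 : u1s h₁ h₂ ≤ 1 := (caseC_u1s_le hC1 hC2 h2).trans (caseC_inv_le hC1)
  intro x hx
  simp only [BxC, boxRegion', mem_setOf_eq] at hx
  obtain ⟨a1, a2, a3, a4, a5, a6⟩ := hx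
  have a4' : x 2 < 1 - x 1 := a4.trans_le (caseC_ell_le hC1 h01 hC2 a2.le)
  have a6' := (lt_div_iff₀ h0).mp a6
  have p1 : 0 ≤ h₁ * x 1 := mul_nonneg (by linarith) a1.le
  have p2 : 0 ≤ h₂ * x 2 := mul_nonneg h2.le a3.le
  rw [mem_Icc, Pi.le_def, Pi.le_def, Fin.forall_fin_succ, Fin.forall_fin_succ, Fin.forall_fin_one,
    Fin.forall_fin_succ, Fin.forall_fin_succ, Fin.forall_fin_one]
  simp only [Fin.succ_zero_eq_one, Fin.succ_one_eq_two]
  refine ⟨⟨by linarith, by linarith, by linarith⟩, ?_, by linarith, by linarith⟩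
  nlinarith

/-- Case C, value of box 0. [folklore] -/
def caseC_v0 (h₀ h₁ h₂ : ℝ) : ℝ :=
  (-(h₀ - 1) * (h₀ * h₂ - 2 * h₀ + h₂) / (2 * h₀ * (h₀ - h₂) ^ 2)) * (u1s h₁ h₂ - 0) +
    (-(h₀ ^ 2 * h₁ - h₀ ^ 2 * h₂ + h₀ ^ 2 - 2 * h₀ * h₁ + h₁ * h₂) / (h₀ * (h₀ - h₂) ^ 2)) *
      ((u1s h₁ h₂ ^ 2 - 0 ^ 2) / 2) +
    ((h₀ - h₁) * (2 * h₀ * h₁ - h₀ * h₂ - h₁ * h₂) / (2 * h₀ * (h₀ - h₂) ^ 2)) *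
      ((u1s h₁ h₂ ^ 3 - 0 ^ 3) / 3)

/-- Case C, box 0: the height integral. [folklore] -/
theorem caseC_int0 (hC1 : 1 < h₁) (h01 : h₁ < h₀) (hC2 : h₂ ≤ 1) :
    ∫ v in (0 : ℝ)..u1s h₁ h₂, ∫ u in (fun _ : ℝ => (0 : ℝ)) v..ell h₀ h₁ h₂ v,
      (Uh h₀ h₁ h₂ u v - (fun _ _ : ℝ => (0 : ℝ)) u v) = caseC_v0 h₀ h₁ h₂ := by
  have d02 : 0 < h₀ - h₂ := by linarith
  have h0 : 0 < h₀ := by linarith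
  have h1 : ∀ v : ℝ, ∫ u in (0 : ℝ)..ell h₀ h₁ h₂ v, (Uh h₀ h₁ h₂ u v - 0) =
      (-(h₀ - 1) * (h₀ * h₂ - 2 * h₀ + h₂) / (2 * h₀ * (h₀ - h₂) ^ 2)) +
      (-(h₀ ^ 2 * h₁ - h₀ ^ 2 * h₂ + h₀ ^ 2 - 2 * h₀ * h₁ + h₁ * h₂) / (h₀ * (h₀ - h₂) ^ 2)) * v +
      ((h₀ - h₁) * (2 * h₀ * h₁ - h₀ * h₂ - h₁ * h₂) / (2 * h₀ * (h₀ - h₂) ^ 2)) * v ^ 2 := by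
    intro v
    have : (fun u : ℝ => Uh h₀ h₁ h₂ u v - 0) = fun u => (1 - h₁ * v) / h₀ + (-h₂ / h₀) * u := by
      funext u; unfold Uh; ring
    rw [this, integral_affine, ell]
    field_simp
    ring
  simp only
  simp_rw [h1]
  rw [integral_quadratic, caseC_v0]

/-- Case C, box 0: volume. [folklore] -/
theorem caseC_vol0 (hC1 : 1 < h₁) (h01 : h₁ < h₀) (hC2 : h₂ ≤ 1) (h2 : 0 < h₂) :
    volume (BxC h₀ h₁ h₂ 0) = ENNReal.ofReal (caseC_v0 h₀ h₁ h₂) ∧ 0 ≤ caseC_v0 h₀ h₁ h₂ := by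
  rw [← caseC_int0 hC1 h01 hC2]
  refine ⟨?_, integral_boxHeight_nonneg (caseC_u1s_nonneg hC1 hC2) (caseC_hM0 hC1 h01 hC2 h2)
    (caseC_hLU0 hC1 h01 hC2 h2)⟩
  simp only [BxC]
  exact volume_boxRegion'_eq (by fun_prop) (by unfold ell; fun_prop) (by fun_prop)
    (by unfold Uh; fun_prop) (caseC_u1s_nonneg hC1 hC2) (caseC_hM0 hC1 h01 hC2 h2)
    (caseC_hLU0 hC1 h01 hC2 h2) (caseC_bd0 hC1 h01 hC2 h2)

/-- Case C, box 1: middle bounds ordered. [folklore] -/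
theorem caseC_hM1 (hC1 : 1 < h₁) (h01 : h₁ < h₀) (hC2 : h₂ ≤ 1) :
    ∀ v, 0 ≤ v → v ≤ u1s h₁ h₂ → ell h₀ h₁ h₂ v ≤ (fun v : ℝ => 1 - v) v :=
  fun _ _ hv => caseC_ell_le hC1 h01 hC2 hv

/-- Case C, box 1 is bounded. [folklore] -/
theorem caseC_bd1 (hC1 : 1 < h₁) (h01 : h₁ < h₀) (hC2 : h₂ ≤ 1) (h2 : 0 < h₂) :
    BxC h₀ h₁ h₂ 1 ⊆ Icc (fun _ => -1) (fun _ => 1) := by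
  intro x hx
  simp only [BxC, boxRegion', mem_setOf_eq] at hx
  obtain ⟨a1, a2, a3, a4, a5, a6⟩ := hx
  have a3' : 0 ≤ x 2 :=
    (caseC_ell_nonneg hC1 h01 hC2 (a2.le.trans (caseC_u1s_le hC1 hC2 h2))).trans a3.le
  rw [mem_Icc, Pi.le_def, Pi.le_def, Fin.forall_fin_succ, Fin.forall_fin_succ, Fin.forall_fin_one,
    Fin.forall_fin_succ, Fin.forall_fin_succ, Fin.forall_fin_one]
  simp only [Fin.succ_zero_eq_one, Fin.succ_one_eq_two]
  exact ⟨⟨by linarith, by linarith, by linarith⟩, by linarith, by linarith, by linarith⟩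

/-- Case C, value of box 1. [folklore] -/
def caseC_v1 (h₀ h₁ h₂ : ℝ) : ℝ :=
  (h₂ - 1) ^ 2 / (2 * (h₀ - h₂) ^ 2) * (u1s h₁ h₂ - 0) +
    (h₁ - h₂) * (h₂ - 1) / (h₀ - h₂) ^ 2 * ((u1s h₁ h₂ ^ 2 - 0 ^ 2) / 2) +
    (h₁ - h₂) ^ 2 / (2 * (h₀ - h₂) ^ 2) * ((u1s h₁ h₂ ^ 3 - 0 ^ 3) / 3)

/-- Case C, box 1: the height integral. [folklore] -/
theorem caseC_int1 (hC1 : 1 < h₁) (h01 : h₁ < h₀) (hC2 : h₂ ≤ 1) :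
    ∫ v in (0 : ℝ)..u1s h₁ h₂, ∫ u in ell h₀ h₁ h₂ v..(fun v : ℝ => 1 - v) v,
      ((fun u v : ℝ => 1 - v - u) u v - (fun _ _ : ℝ => (0 : ℝ)) u v) = caseC_v1 h₀ h₁ h₂ := by
  have d02 : 0 < h₀ - h₂ := by linarith
  have h1 : ∀ v : ℝ, ∫ u in ell h₀ h₁ h₂ v..(1 - v), (1 - v - u - 0) =
      (h₂ - 1) ^ 2 / (2 * (h₀ - h₂) ^ 2) + ((h₁ - h₂) * (h₂ - 1) / (h₀ - h₂) ^ 2) * v +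
      ((h₁ - h₂) ^ 2 / (2 * (h₀ - h₂) ^ 2)) * v ^ 2 := by
    intro v
    have : (fun u : ℝ => 1 - v - u - 0) = fun u => (1 - v) + (-1) * u := by funext u; ring
    rw [this, integral_affine, ell]
    field_simp
    ring
  simp only
  simp_rw [h1]
  rw [integral_quadratic, caseC_v1]

/-- Case C, box 1: volume. [folklore] -/
theorem caseC_vol1 (hC1 : 1 < h₁) (h01 : h₁ < h₀) (hC2 : h₂ ≤ 1) (h2 : 0 < h₂) :
    volume (BxC h₀ h₁ h₂ 1) = ENNReal.ofReal (caseC_v1 h₀ h₁ h₂) ∧ 0 ≤ caseC_v1 h₀ h₁ h₂ := by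
  rw [← caseC_int1 hC1 h01 hC2]
  refine ⟨?_, integral_boxHeight_nonneg (caseC_u1s_nonneg hC1 hC2) (caseC_hM1 hC1 h01 hC2)
    caseB_hLU12⟩
  simp only [BxC]
  exact volume_boxRegion'_eq (by unfold ell; fun_prop) (by fun_prop) (by fun_prop)
    (by fun_prop) (caseC_u1s_nonneg hC1 hC2) (caseC_hM1 hC1 h01 hC2) caseB_hLU12
    (caseC_bd1 hC1 h01 hC2 h2)

/-- Case C, box 2: middle bounds ordered. [folklore] -/
theorem caseC_hM2 (hC1 : 1 < h₁) (h2 : 0 < h₂) :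
    ∀ v, u1s h₁ h₂ ≤ v → v ≤ 1 / h₁ → (fun _ : ℝ => (0 : ℝ)) v ≤ (fun v : ℝ => (1 - h₁ * v) / h₂) v := by
  intro v _ hv
  have h1 : 0 < h₁ := by linarith
  have hv' := (le_div_iff₀ h1).mp hv
  exact div_nonneg (by linarith) h2.le

/-- Case C, box 2: inner bounds ordered. [folklore] -/
theorem caseC_hLU2 (hC1 : 1 < h₁) (h01 : h₁ < h₀) (h2 : 0 < h₂) :
    ∀ v, u1s h₁ h₂ ≤ v → v ≤ 1 / h₁ → ∀ u, (fun _ : ℝ => (0 : ℝ)) v ≤ u →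
      u ≤ (fun v : ℝ => (1 - h₁ * v) / h₂) v → (fun _ _ : ℝ => (0 : ℝ)) u v ≤ Uh h₀ h₁ h₂ u v := by
  intro v _ _ u _ hu
  have hu' := (le_div_iff₀ h2).mp hu
  have h0 : 0 < h₀ := by linarith
  unfold Uh
  exact div_nonneg (by linarith) h0.le

/-- Case C, box 2 is bounded. [folklore] -/
theorem caseC_bd2 (hC1 : 1 < h₁) (h01 : h₁ < h₀) (hC2 : h₂ ≤ 1) (h2 : 0 < h₂) :
    BxC h₀ h₁ h₂ 2 ⊆ Icc (fun _ => -1) (fun _ => 1) := by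
  have h0 : 0 < h₀ := by linarith
  have h1 : 0 < h₁ := by linarith
  have d12 : 0 < h₁ - h₂ := by linarith
  have hu0 := caseC_u1s_nonneg hC1 hC2
  intro x hx
  simp only [BxC, boxRegion', mem_setOf_eq] at hx
  obtain ⟨a1, a2, a3, a4, a5, a6⟩ := hx
  have a1' := (div_lt_iff₀ d12).mp a1
  have a2' := (lt_div_iff₀ h1).mp a2
  have a4' := (lt_div_iff₀ h2).mp a4
  have a6' := (lt_div_iff₀ h0).mp a6
  have hx1 : 0 ≤ x 1 := hu0.trans a1.le
  have p1 : 0 ≤ h₂ * x 1 := mul_nonneg h2.le hx1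
  have p2 : 0 ≤ h₂ * x 2 := mul_nonneg h2.le a3.le
  have p3 : 0 ≤ h₁ * x 1 := mul_nonneg h1.le hx1
  rw [mem_Icc, Pi.le_def, Pi.le_def, Fin.forall_fin_succ, Fin.forall_fin_succ, Fin.forall_fin_one,
    Fin.forall_fin_succ, Fin.forall_fin_succ, Fin.forall_fin_one]
  simp only [Fin.succ_zero_eq_one, Fin.succ_one_eq_two]
  refine ⟨⟨by linarith, by linarith, by linarith⟩, by nlinarith, by nlinarith, ?_⟩
  have : h₂ * x 2 < h₂ * 1 := by nlinarith
  exact (lt_of_mul_lt_mul_left this h2.le).le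

/-- Case C, value of box 2. [folklore] -/
def caseC_v2 (h₀ h₁ h₂ : ℝ) : ℝ :=
  1 / (2 * h₀ * h₂) * (1 / h₁ - u1s h₁ h₂) + (-h₁ / (h₀ * h₂)) * (((1 / h₁) ^ 2 - u1s h₁ h₂ ^ 2) / 2) +
    h₁ ^ 2 / (2 * h₀ * h₂) * (((1 / h₁) ^ 3 - u1s h₁ h₂ ^ 3) / 3)

/-- Case C, box 2: the height integral. [folklore] -/
theorem caseC_int2 (h01 : h₁ < h₀) (hC1 : 1 < h₁) (h2 : 0 < h₂) :
    ∫ v in u1s h₁ h₂..(1 / h₁), ∫ u in (fun _ : ℝ => (0 : ℝ)) v..(fun v : ℝ => (1 - h₁ * v) / h₂) v,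
      (Uh h₀ h₁ h₂ u v - (fun _ _ : ℝ => (0 : ℝ)) u v) = caseC_v2 h₀ h₁ h₂ := by
  have h0 : 0 < h₀ := by linarith
  have h1 : ∀ v : ℝ, ∫ u in (0 : ℝ)..((1 - h₁ * v) / h₂), (Uh h₀ h₁ h₂ u v - 0) =
      1 / (2 * h₀ * h₂) + (-h₁ / (h₀ * h₂)) * v + (h₁ ^ 2 / (2 * h₀ * h₂)) * v ^ 2 := by
    intro v
    have : (fun u : ℝ => Uh h₀ h₁ h₂ u v - 0) = fun u => (1 - h₁ * v) / h₀ + (-h₂ / h₀) * u := by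
      funext u; unfold Uh; ring
    rw [this, integral_affine]
    field_simp
    ring
  simp only
  simp_rw [h1]
  rw [integral_quadratic, caseC_v2]

/-- Case C, box 2: volume. [folklore] -/
theorem caseC_vol2 (hC1 : 1 < h₁) (h01 : h₁ < h₀) (hC2 : h₂ ≤ 1) (h2 : 0 < h₂) :
    volume (BxC h₀ h₁ h₂ 2) = ENNReal.ofReal (caseC_v2 h₀ h₁ h₂) ∧ 0 ≤ caseC_v2 h₀ h₁ h₂ := by
  rw [← caseC_int2 h01 hC1 h2]
  refine ⟨?_, integral_boxHeight_nonneg (caseC_u1s_le hC1 hC2 h2) (caseC_hM2 hC1 h2)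
    (caseC_hLU2 hC1 h01 h2)⟩
  simp only [BxC]
  exact volume_boxRegion'_eq (by fun_prop) (by fun_prop) (by fun_prop) (by unfold Uh; fun_prop)
    (caseC_u1s_le hC1 hC2 h2) (caseC_hM2 hC1 h2) (caseC_hLU2 hC1 h01 h2) (caseC_bd2 hC1 h01 hC2 h2)

/-- The case-C volume of `V(h)`. [folklore] -/
def VC (h₀ h₁ h₂ : ℝ) : ℝ :=
  (h₀ * h₁ * h₂ ^ 2 - 3 * h₀ * h₁ * h₂ + 3 * h₀ * h₁ - h₀ - h₁ + h₂) /
    (6 * h₀ * h₁ * (h₀ - h₂) * (h₁ - h₂))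

/-- **Case C**: `vol V(h) = V_C(h)` when `0 < h₂ ≤ 1 < h₁ < h₀`. [folklore] -/
theorem volume_Vset_caseC (hC1 : 1 < h₁) (h01 : h₁ < h₀) (hC2 : h₂ ≤ 1) (h2 : 0 < h₂) :
    volume (Vset h₀ h₁ h₂) = ENNReal.ofReal (VC h₀ h₁ h₂) := by
  have d01 : (h₀ - h₁) ≠ 0 := by linarith
  have d02 : (h₀ - h₂) ≠ 0 := by linarith
  have d12 : (h₁ - h₂) ≠ 0 := by linarith
  have h0 : h₀ ≠ 0 := by linarith
  have h1 : h₁ ≠ 0 := by linarith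
  have h2' : h₂ ≠ 0 := h2.ne'
  obtain ⟨e0, n0⟩ := caseC_vol0 hC1 h01 hC2 h2
  obtain ⟨e1, n1⟩ := caseC_vol1 hC1 h01 hC2 h2
  obtain ⟨e2, n2⟩ := caseC_vol2 hC1 h01 hC2 h2
  rw [volume_eq_sum_boxes (Vset h₀ h₁ h₂) (BxC h₀ h₁ h₂) (BcxC h₀ h₁ h₂) caseC_meas
    (caseC_sub hC1 h01 hC2 h2) (caseC_cover hC1 h01 h2) caseC_null caseC_disj, Fin.sum_univ_three,
    e0, e1, e2, ← ENNReal.ofReal_add n0 n1, ← ENNReal.ofReal_add (add_nonneg n0 n1) n2]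
  congr 1
  rw [caseC_v0, caseC_v1, caseC_v2, VC, u1s]
  field_simp
  ring

end caseC

/-! ## C3. From `cutSimplex e c` to `V(h)`: scaling -/

section scaling

variable {e : Fin 3 → ℝ} {c : ℝ}

/-- The slopes `hᵢ = c eᵢ / ((½ − c)(½ − eᵢ))`. [folklore] -/
def hcoef (e : Fin 3 → ℝ) (c : ℝ) (i : Fin 3) : ℝ := c * e i / ((1 / 2 - c) * (1 / 2 - e i))

/-- The diagonal scaling `sᵢ ↦ sᵢ / (c eᵢ)`. [folklore] -/
def scaleMap (e : Fin 3 → ℝ) (c : ℝ) : (Fin 3 → ℝ) →ₗ[ℝ] (Fin 3 → ℝ) :=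
  Matrix.toLin' (Matrix.diagonal fun i => (c * e i)⁻¹)

/-- The scaling acts coordinatewise. [folklore] -/
theorem scaleMap_apply (s : Fin 3 → ℝ) (i : Fin 3) : scaleMap e c s i = (c * e i)⁻¹ * s i := by
  simp [scaleMap, Matrix.toLin'_apply, Matrix.mulVec_diagonal]

/-- Determinant of the scaling. [folklore] -/
theorem det_scaleMap :
    LinearMap.det (scaleMap e c) = (c * e 0)⁻¹ * (c * e 1)⁻¹ * (c * e 2)⁻¹ := by
  rw [scaleMap, LinearMap.det_toLin', Matrix.det_diagonal, Fin.prod_univ_three]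

/-- **Scaling**: `cutSimplex e c` is the preimage of `V(h)` under `s ↦ (sᵢ/(c eᵢ))ᵢ`. [folklore] -/
theorem cutSimplex_eq_preimage (hc : 0 < c) (hc' : c < 1 / 2) (he : ∀ i, 0 < e i)
    (he' : ∀ i, e i < 1 / 2) :
    cutSimplex e c = scaleMap e c ⁻¹' Vset (hcoef e c 0) (hcoef e c 1) (hcoef e c 2) := by
  have hce : ∀ i, 0 < c * e i := fun i => mul_pos hc (he i)
  ext s
  simp only [cutSimplex, Vset, mem_setOf_eq, mem_preimage, scaleMap_apply, Fin.sum_univ_three,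
    hcoef]
  have hpos : ∀ i, (0 ≤ (c * e i)⁻¹ * s i ↔ 0 ≤ s i) := fun i =>
    ⟨fun h => by
      have := mul_nonneg (hce i).le h
      rwa [← mul_assoc, mul_inv_cancel₀ (hce i).ne', one_mul] at this,
     fun h => mul_nonneg (inv_nonneg.2 (hce i).le) h⟩
  have h1 : (c * e 0)⁻¹ * s 0 + (c * e 1)⁻¹ * s 1 + (c * e 2)⁻¹ * s 2 =
      (s 0 / e 0 + s 1 / e 1 + s 2 / e 2) / c := by
    field_simp
  have h2 : c * e 0 / ((1 / 2 - c) * (1 / 2 - e 0)) * ((c * e 0)⁻¹ * s 0) +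
      c * e 1 / ((1 / 2 - c) * (1 / 2 - e 1)) * ((c * e 1)⁻¹ * s 1) +
      c * e 2 / ((1 / 2 - c) * (1 / 2 - e 2)) * ((c * e 2)⁻¹ * s 2) =
      (s 0 / (1 / 2 - e 0) + s 1 / (1 / 2 - e 1) + s 2 / (1 / 2 - e 2)) / (1 / 2 - c) := by
    have h0 : (1 / 2 - e 0) ≠ 0 := by linarith [he' 0]
    have h1' : (1 / 2 - e 1) ≠ 0 := by linarith [he' 1]
    have h2' : (1 / 2 - e 2) ≠ 0 := by linarith [he' 2]
    have hc2 : (1 / 2 - c) ≠ 0 := by linarith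
    have := (hce 0).ne'; have := (hce 1).ne'; have := (hce 2).ne'
    have := (he 0).ne'; have := (he 1).ne'; have := (he 2).ne'; have := hc.ne'
    field_simp
  rw [h1, h2, div_le_one hc, div_le_one (by linarith), Fin.forall_fin_succ, Fin.forall_fin_succ,
    Fin.forall_fin_one]
  simp only [Fin.succ_zero_eq_one, Fin.succ_one_eq_two, hpos]

/-- **Volume scaling**: `vol (cutSimplex e c) = c³ e₀ e₁ e₂ · vol V(h)`. [folklore] -/
theorem volume_cutSimplex_eq_scaled (hc : 0 < c) (hc' : c < 1 / 2) (he : ∀ i, 0 < e i)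
    (he' : ∀ i, e i < 1 / 2) :
    volume (cutSimplex e c) = ENNReal.ofReal (c ^ 3 * e 0 * e 1 * e 2) *
      volume (Vset (hcoef e c 0) (hcoef e c 1) (hcoef e c 2)) := by
  have hce : ∀ i, 0 < c * e i := fun i => mul_pos hc (he i)
  have hdet : LinearMap.det (scaleMap e c) ≠ 0 := by
    rw [det_scaleMap]
    exact mul_ne_zero (mul_ne_zero (inv_ne_zero (hce 0).ne') (inv_ne_zero (hce 1).ne'))
      (inv_ne_zero (hce 2).ne')
  have hdet' : (LinearMap.det (scaleMap e c))⁻¹ = c ^ 3 * e 0 * e 1 * e 2 := by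
    rw [det_scaleMap]
    have := (hce 0).ne'; have := (hce 1).ne'; have := (hce 2).ne'
    field_simp
  rw [cutSimplex_eq_preimage hc hc' he he', Measure.addHaar_preimage_linearMap volume hdet, hdet']
  congr 2
  have := he 0; have := he 1; have := he 2
  exact abs_of_pos (by positivity)

/-- The slopes are positive. [folklore] -/
theorem hcoef_pos (hc : 0 < c) (hc' : c < 1 / 2) (he : ∀ i, 0 < e i) (he' : ∀ i, e i < 1 / 2)
    (i : Fin 3) : 0 < hcoef e c i :=
  div_pos (mul_pos hc (he i)) (mul_pos (by linarith) (by linarith [he' i]))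

/-- The slopes increase with `eᵢ`. [folklore] -/
theorem hcoef_lt (hc : 0 < c) (hc' : c < 1 / 2) (he : ∀ i, 0 < e i) (he' : ∀ i, e i < 1 / 2)
    {i j : Fin 3} (hij : e i < e j) : hcoef e c i < hcoef e c j := by
  unfold hcoef
  have hi := he' i; have hj := he' j; have := he i
  rw [div_lt_div_iff₀ (mul_pos (by linarith) (by linarith)) (mul_pos (by linarith) (by linarith))]
  have hc2 : 0 < 1 / 2 - c := by linarith
  nlinarith [mul_pos hc hc2, mul_pos (mul_pos hc hc2) hc]

/-- `hᵢ ≤ 1 ↔ eᵢ + c ≤ ½`. [folklore] -/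
theorem hcoef_le_one_iff (hc' : c < 1 / 2) (he' : ∀ i, e i < 1 / 2) (i : Fin 3) :
    hcoef e c i ≤ 1 ↔ e i + c ≤ 1 / 2 := by
  unfold hcoef
  have hi := he' i
  rw [div_le_one (mul_pos (by linarith) (by linarith))]
  constructor <;> intro h <;> nlinarith

/-- Differences of slopes factor: `hᵢ − hⱼ = c (eᵢ − eⱼ) / (2 (½−c)(½−eᵢ)(½−eⱼ))`. [folklore] -/
theorem hcoef_sub (hc' : c < 1 / 2) (he' : ∀ i, e i < 1 / 2) (i j : Fin 3) :
    hcoef e c i - hcoef e c j =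
      c * (e i - e j) / (2 * (1 / 2 - c) * (1 / 2 - e i) * (1 / 2 - e j)) := by
  unfold hcoef
  have hi : (1 / 2 - e i) ≠ 0 := by linarith [he' i]
  have hj : (1 / 2 - e j) ≠ 0 := by linarith [he' j]
  have hc2 : (1 / 2 - c) ≠ 0 := by linarith
  rw [div_sub_div _ _ (mul_ne_zero hc2 hi) (mul_ne_zero hc2 hj),
    div_eq_div_iff (mul_ne_zero (mul_ne_zero hc2 hi) (mul_ne_zero hc2 hj))
      (mul_ne_zero (mul_ne_zero (mul_ne_zero two_ne_zero hc2) hi) hj)]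
  ring

end scaling

/-! ## C4. The piecewise closed form `Π(e; c)` -/

/-- `term₀ = (2c−1)³(2e₀−1)(2e₁−1)(2e₂−1)/384`. [folklore] -/
def piTerm0 (e : Fin 3 → ℝ) (c : ℝ) : ℝ :=
  (2 * c - 1) ^ 3 * (2 * e 0 - 1) * (2 * e 1 - 1) * (2 * e 2 - 1) / 384

/-- `term₂ = −e₀e₂(2e₀−1)(2e₂−1)(2c+2e₁−1)³/(384 (e₀−e₁)(e₁−e₂))`. [folklore] -/
def piTerm2 (e : Fin 3 → ℝ) (c : ℝ) : ℝ :=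
  -(e 0 * e 2 * (2 * e 0 - 1) * (2 * e 2 - 1) * (2 * c + 2 * e 1 - 1) ^ 3) /
    (384 * (e 0 - e 1) * (e 1 - e 2))

/-- `term₃ = e₀e₁(2e₀−1)(2e₁−1)(2c+2e₂−1)³/(384 (e₀−e₂)(e₁−e₂))`. [folklore] -/
def piTerm3 (e : Fin 3 → ℝ) (c : ℝ) : ℝ :=
  e 0 * e 1 * (2 * e 0 - 1) * (2 * e 1 - 1) * (2 * c + 2 * e 2 - 1) ^ 3 /
    (384 * (e 0 - e 2) * (e 1 - e 2))

/-- The piecewise rational volume `Π(e; c)` of the cut simplex (pieces 3, 2, 1 of the peeling;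
the divided-difference formula for a simplex cut by a half-space). [folklore] -/
def cutSimplexVol (e : Fin 3 → ℝ) (c : ℝ) : ℝ :=
  if e 0 + c ≤ 1 / 2 then c ^ 3 * e 0 * e 1 * e 2 / 6
  else if e 1 + c ≤ 1 / 2 then piTerm0 e c + piTerm3 e c + piTerm2 e c
  else piTerm0 e c + piTerm3 e c

set_option maxRecDepth 20000 in
set_option maxHeartbeats 1600000 in
/-- **Volume of the cut simplex** for sorted `½ > e₀ > e₁ > e₂ > 0` and `0 < c` with
`e₂ + c ≤ ½`: `vol₃ (cutSimplex e c) = Π(e; c)`. [folklore] -/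
theorem volume_cutSimplex {e : Fin 3 → ℝ} {c : ℝ} (he0 : e 0 < 1 / 2) (h01 : e 1 < e 0)
    (h12 : e 2 < e 1) (he2 : 0 < e 2) (hc : 0 < c) (hc2 : e 2 + c ≤ 1 / 2) :
    volume (cutSimplex e c) = ENNReal.ofReal (cutSimplexVol e c) := by
  have hc' : c < 1 / 2 := by linarith
  have he : ∀ i, 0 < e i := by
    intro i; fin_cases i
    · show 0 < e 0; linarith
    · show 0 < e 1; linarith
    · show 0 < e 2; exact he2
  have he' : ∀ i, e i < 1 / 2 := by
    intro i; fin_cases i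
    · show e 0 < 1 / 2; exact he0
    · show e 1 < 1 / 2; linarith
    · show e 2 < 1 / 2; linarith
  have hp := hcoef_pos hc hc' he he'
  have hlt01 : hcoef e c 1 < hcoef e c 0 := hcoef_lt hc hc' he he' (i := 1) (j := 0) h01
  have hlt12 : hcoef e c 2 < hcoef e c 1 := hcoef_lt hc hc' he he' (i := 2) (j := 1) h12
  have hle2 : hcoef e c 2 ≤ 1 := (hcoef_le_one_iff hc' he' 2).mpr hc2
  have hprod : 0 ≤ c ^ 3 * e 0 * e 1 * e 2 := by
    have := he 0; have := he 1; positivity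
  -- nonzero facts for `field_simp`
  have n0 : (1 / 2 - e 0) ≠ 0 := by linarith
  have n1 : (1 / 2 - e 1) ≠ 0 := by linarith
  have n2 : (1 / 2 - e 2) ≠ 0 := by linarith
  have nc : (1 / 2 - c) ≠ 0 := by linarith
  have m01 : (e 0 - e 1) ≠ 0 := by linarith
  have m02 : (e 0 - e 2) ≠ 0 := by linarith
  have m12 : (e 1 - e 2) ≠ 0 := by linarith
  have z0 := (he 0).ne'; have z1 := (he 1).ne'; have z2 := (he 2).ne'; have zc := hc.ne'
  have hh0 : hcoef e c 0 ≠ 0 := (hp 0).ne'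
  have hh1 : hcoef e c 1 ≠ 0 := (hp 1).ne'
  rw [volume_cutSimplex_eq_scaled hc hc' he he']
  unfold cutSimplexVol
  by_cases hA : e 0 + c ≤ 1 / 2
  · -- case A
    have hA' : hcoef e c 0 ≤ 1 := (hcoef_le_one_iff hc' he' 0).mpr hA
    rw [if_pos hA, volume_Vset_caseA hA' hlt01.le hlt12.le, ← ENNReal.ofReal_mul hprod]
    congr 1; ring
  · rw [if_neg hA]
    have hA' : 1 < hcoef e c 0 := by
      have := (hcoef_le_one_iff hc' he' 0).not.mpr hA; push Not at this; exact this
    by_cases hB : e 1 + c ≤ 1 / 2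
    · -- case B
      have hB' : hcoef e c 1 ≤ 1 := (hcoef_le_one_iff hc' he' 1).mpr hB
      rw [if_pos hB, volume_Vset_caseB hA' hB' hlt12.le (hp 2).le, ← ENNReal.ofReal_mul hprod]
      congr 1
      rw [VB, show hcoef e c 0 - hcoef e c 1 = _ from hcoef_sub hc' he' 0 1,
        show hcoef e c 0 - hcoef e c 2 = _ from hcoef_sub hc' he' 0 2]
      unfold piTerm0 piTerm2 piTerm3 hcoef
      set Pc := 1 / 2 - c with hPc
      set P0 := 1 / 2 - e 0 with hP0
      set P1 := 1 / 2 - e 1 with hP1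
      set P2 := 1 / 2 - e 2 with hP2
      field_simp
      rw [hPc, hP0, hP1, hP2]
      ring
    · -- case C
      have hB' : 1 < hcoef e c 1 := by
        have := (hcoef_le_one_iff hc' he' 1).not.mpr hB; push Not at this; exact this
      rw [if_neg hB, volume_Vset_caseC hB' hlt01 hle2 (hp 2), ← ENNReal.ofReal_mul hprod]
      congr 1
      rw [VC, show hcoef e c 0 - hcoef e c 2 = _ from hcoef_sub hc' he' 0 2,
        show hcoef e c 1 - hcoef e c 2 = _ from hcoef_sub hc' he' 1 2]
      unfold piTerm0 piTerm3 hcoef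
      set Pc := 1 / 2 - c with hPc
      set P0 := 1 / 2 - e 0 with hP0
      set P1 := 1 / 2 - e 1 with hP1
      set P2 := 1 / 2 - e 2 with hP2
      field_simp
      rw [hPc, hP0, hP1, hP2]
      ring

/-- `Π(e; c) ≥ 0` under the hypotheses of `volume_cutSimplex` (it is a volume). [folklore] -/
theorem cutSimplexVol_nonneg {e : Fin 3 → ℝ} {c : ℝ} (he0 : e 0 < 1 / 2) (h01 : e 1 < e 0)
    (h12 : e 2 < e 1) (he2 : 0 < e 2) (hc : 0 < c) (hc2 : e 2 + c ≤ 1 / 2)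
    (hfin : volume (cutSimplex e c) ≠ 0) : 0 ≤ cutSimplexVol e c := by
  by_contra h
  push Not at h
  rw [volume_cutSimplex he0 h01 h12 he2 hc hc2, ENNReal.ofReal_eq_zero.2 h.le] at hfin
  exact hfin rfl

end ZhangJiangXie2025

end Literature.Probability.RandomMatrix

end
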